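import Literature.NumberTheory.EllipticCurves.Newforms
import Literature.NumberTheory.EllipticCurves.NewformGaloisRep
import Literature.NumberTheory.GaloisRepresentations.ContinuousRep
import Literature.NumberTheory.GaloisRepresentations.GaloisRep
import Literature.NumberTheory.GaloisRepresentations.ModPGaloisRep
import Literature.NumberTheory.GaloisRepresentations.SerreWeight
import HarnessLib

-- D-0014 sorry-sweep (operator, 2026-08-13): sorried theorems -> named facts `def X : Prop`; partial proofs preserved in comments
-- provenance: harness21/H21/H21/Statements/Lang/SerreConjecture.lean @ dfb519f (interim HEAD d8f2665); M5 mechanical rewrite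
/-!
# Serre's modularity conjecture (family `lang`, trunk EllArithM; statement **lang.S37**)

Informal content.  Let `p` be a prime and `k ⊇ 𝔽̄_p` an algebraically closed field of
characteristic `p` with the discrete topology.  Let `ρ̄ : Γ_ℚ → GL₂(k)` be a continuous,
irreducible, *odd* representation (`Literature.ModPGaloisRep ℚ k 2`, item G09).

* **lang.S37**, strong form (Serre, Duke Math. J. 54 (1987), (3.2.4)): `ρ̄` arises from a
  newform `f` of level `N(ρ̄)` (`Literature.ModPGaloisRep.serreLevel p ρ̄`, the prime-to-`p` Artin
  conductor) and weight `k(ρ̄)` (`Literature.ModPGaloisRep.serreWeight p ρ̄ loc ι`, Serre's recipe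
  §2): there are a newform `f ∈ S_{k(ρ̄)}(Γ₁(N(ρ̄)))` and a ring homomorphism
  `ι : 𝓞_f → k` (reduction of the ring of integers of the coefficient field modulo a prime
  above `p`) with `charpoly ρ̄(Frob_q) = ι(X² − a_q(f) X + ε(q) q^{k−1})` for all `q ∤ N p`
  (`Literature.NumberTheory.EllipticCurves.ModularForms.IsGaloisRepOfNewform1Int`).  Proved by Khare–Wintenberger, Invent.
  Math. 178 (2009): Thm. 1.2 (the cases `p` odd with `N(ρ̄)` odd, and `p = 2` with `k(ρ̄) = 2`)
  and Thm. 9.1 (the general case, under Hypothesis (H), which is Kisin, Invent. Math. 178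
  (2009), 587–634, Thm. 0.1 and Cor. 0.2); cf. op. cit. §10, first paragraph: "Serre's
  conjecture (Theorem 1.2 and 9.1 of this paper, and Theorem 0.1 and Corollary 0.2 of [19])".
  Stated as the proposition `SerreModularityConjecture p k` plus the named fact
  `khare_wintenberger p k` (to be discharged by a `khare_wintenberger_holds`).
* **lang.S37**, weak form (Serre, loc. cit., (3.2.3)): `ρ̄` arises from *some* newform (some
  level and weight): `exists_newform_of_odd_irreducible`.

## Mathlib search

Mathlib (this pin) has `CuspForm`, `CongruenceSubgroup.Gamma1`, `Field.absoluteGaloisGroup`,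
`IsAlgClosed`, `CharP`, but no mod `p` Galois representations, Serre level/weight or newforms
(grep `[Ss]erre` in `Mathlib/NumberTheory`: only Hasse-bound / unrelated hits; `[Nn]ewform`:
none).  Everything is assembled from the accepted H21 preludes: `IsNewform1`,
`coeffCharIntegers`, `IsGaloisRepOfNewform1Int` (EllArithM), `ModPGaloisRep`, `serreLevel`,
`serreWeight`, `LocalRestrictionAt`, `FramedGaloisRep.IsOdd`, `ContinuousRep.IsIrreducible`
(GalRep).  Nothing new is defined besides the statements.

## Design choices

* **Level.**  `CuspForm (Gamma1 N) _`-newforms need `[NeZero N]`.  Since `¬ p ∣ N(ρ̄)` is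
  proved sorry-free (`ModPGaloisRep.not_dvd_serreLevel`), the instance
  `NeZero (serreLevel p ρ̄)` is built inline in the statement from that lemma (no `∀ N, … = N`
  indirection).
* **Hypotheses of the `def`.**  The hypotheses "`k` has characteristic `p`" and "`k` is
  algebraically closed" are part of Serre's statement but are not consumed by any of the
  H21 predicates in the body; to keep them in the statement without unused arguments,
  `SerreModularityConjecture p k` is the proposition
  `∀ [CharP k p] [IsAlgClosed k], ∀ ρ̄, …` (premises inside the `Prop`), while the binders of
  the `def` are only `(p) [Fact p.Prime] (k) [Field k] [TopologicalSpace k]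
  [DiscreteTopology k]`.
* **"Arises from `f`".**  `IsGaloisRepOfNewform1Int f ι S ρ̄` says: `ρ̄` is unramified at all
  primes `q ∉ S` with `charpoly ρ̄(Frob_q) = ι(X² − a_q X + ε(q) q^{k−1})`.  For irreducible
  `ρ̄` this is equivalent to `ρ̄ ≅ ρ̄_{f,ι}` (Brauer–Nesbitt and Chebotarev), which is Serre's
  "`ρ` provient de `f`".
* **Weight.**  The G09 weight `serreWeight p ρ̄ loc ι` depends on a *local restriction datum*
  `loc : LocalRestrictionAt p ρ̄` (an abstract copy of `ℚ_p` with `ρ̄|Γ_{ℚ_p}`; it replaces the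
  missing `IsNonarchimedeanLocalField ℚ_[p]` instance) and a residue embedding
  `ι : 𝔽̄_p →+* k`.  Serre's `k(ρ̄)` does not depend on these choices, so the strong form
  quantifies universally over them.
* **Exceptional set.**  The representation attached to `f` mod `p` is unramified and has the
  prescribed Frobenius characteristic polynomials at all primes `q ∤ N p`; the exceptional set
  is `{q | q ∣ N * p} : Set ℕ`.
* The weight of `CuspForm` is an integer; `k(ρ̄) : ℕ` is cast to `ℤ`.

## References

* J.-P. Serre, *Sur les représentations modulaires de degré 2 de `Gal(ℚ̄/ℚ)`*, Duke Math. J.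
  54 (1987), §3.2, Conjectures (3.2.3) (weak form) and (3.2.4) (strong form).
* C. Khare, J.-P. Wintenberger, *Serre's modularity conjecture (I)*, Invent. Math. 178
  (2009), 485–504, Thm. 1.2 (§1.1) and Thm. 9.1 (§9); *(II)*, ibid. 505–586 (the lifting
  theorems Thm. 4.1 and Thm. 5.1 used in (I)).
* M. Kisin, *Modularity of 2-adic Barsotti–Tate representations*, Invent. Math. 178 (2009),
  587–634, Thm. 0.1 and Cor. 0.2 (= Hypothesis (H) of Khare–Wintenberger (I), §9).
-/

noncomputable section

open scoped Classical Valued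
open CongruenceSubgroup ValuativeRel

namespace Literature.NumberTheory.Automorphic

open EllipticCurves.ModularForms GaloisRepresentations.ModPGaloisRep GaloisRepresentations.IsNonarchimedeanLocalField

universe v

/-- **lang.S37** (Serre's modularity conjecture, strong form: Serre, Duke Math. J. 54 (1987),
Conjecture (3.2.4); theorem of Khare–Wintenberger, Invent. Math. 178 (2009), Thm. 1.2 and
Thm. 9.1, with Kisin, Invent. Math. 178 (2009), 587–634, Thm. 0.1 and Cor. 0.2 supplying
Hypothesis (H) of Thm. 9.1).  For `p` prime and `k` an algebraically closed field of
characteristic `p` (discrete topology; both hypotheses are premises of the proposition): for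
every continuous, irreducible, odd
`ρ̄ : Γ_ℚ → GL₂(k)`, with Serre level `N(ρ̄)` (nonzero, indeed prime to `p`, by
`ModPGaloisRep.not_dvd_serreLevel`) and Serre weight `k(ρ̄)` (computed from any local
restriction datum `loc` at `p` and residue embedding `ι`), there exist a newform
`f ∈ S_{k(ρ̄)}(Γ₁(N(ρ̄)))` and a ring homomorphism `ι_f : 𝓞_f →+* k` such that `ρ̄` is the
reduction of the Galois representation of `f` along `ι_f`:
`charpoly ρ̄(Frob_q) = ι_f(X² − a_q(f) X + ε_f(q) q^{k(ρ̄)−1})` for all primes `q ∤ N(ρ̄) p`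
(for irreducible `ρ̄` this is equivalent to `ρ̄ ≅ ρ̄_{f,ι_f}` by Brauer–Nesbitt, i.e. Serre's
"`ρ̄` arises from `f`"). [folklore] -/
def SerreModularityConjecture (p : ℕ) [Fact p.Prime] (k : Type v) [Field k]
    [TopologicalSpace k] [DiscreteTopology k] : Prop :=
  ∀ [CharP k p] [IsAlgClosed k], ∀ ρ : Literature.NumberTheory.GaloisRepresentations.ModPGaloisRep ℚ k 2,
    ρ.toGaloisRep.IsIrreducible → GaloisRepresentations.FramedGaloisRep.IsOdd ρ → ∀ (loc : LocalRestrictionAt p ρ)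
      (ι : GaloisRepresentations.absIntegers 𝒪[loc.F] loc.F ⧸ absMaximalIdeal loc.F →+* k),
      haveI : NeZero (serreLevel p ρ) := ⟨fun h => not_dvd_serreLevel p ρ (h ▸ dvd_zero p)⟩
      ∃ (f : CuspForm (Gamma1 (serreLevel p ρ)) (serreWeight p ρ loc ι : ℤ))
        (ιf : coeffCharIntegers f →+* k),
        IsNewform1 f ∧ IsGaloisRepOfNewform1Int f ιf {q | q ∣ serreLevel p ρ * p} ρ

variable (p : ℕ) [Fact p.Prime] (k : Type v) [Field k] [TopologicalSpace k] [DiscreteTopology k]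

/-- **lang.S37** (Khare–Wintenberger, *Serre's modularity conjecture (I)*, Invent. Math. 178
(2009), Thm. 1.2 — `p` odd with `N(ρ̄)` odd, and `p = 2` with `k(ρ̄) = 2` — and Thm. 9.1 — the
general case ("Assume Hypothesis (H). Then Serre's conjecture is true."), Hypothesis (H) being
Kisin, *Modularity of 2-adic Barsotti–Tate representations*, Invent. Math. 178 (2009), Thm. 0.1
and Cor. 0.2, as recorded in Khare–Wintenberger (I), §10, first paragraph): Serre's
conjecture in its strong form (3.2.4) holds
(for every algebraically closed `k` of characteristic `p`; these hypotheses are premises of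
`SerreModularityConjecture p k`).
[cite: KhareWintenberger2009, Thm. 1.2 and Thm. 9.1] [cite: Kisin2009TwoAdic, Thm. 0.1, Cor. 0.2] -/
def khare_wintenberger : Prop :=
  SerreModularityConjecture p k

variable {p k}

/-- **lang.S37** (weak form: Serre, Duke Math. J. 54 (1987), Conjecture (3.2.3);
Khare–Wintenberger, Invent. Math. 178 (2009), Thm. 1.2 and Thm. 9.1, the latter under
Hypothesis (H) = Kisin, Invent. Math. 178 (2009), Thm. 0.1 and Cor. 0.2; the printed theorems
give the strong form (3.2.4), in the tree the named fact `khare_wintenberger p k`, from which this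
weak form follows by the proved `exists_newform_of_odd_irreducible_of_khare_wintenberger` of
`SerreConjectureProofs`).  Every continuous, irreducible, odd
`ρ̄ : Γ_ℚ → GL₂(k)` (`k` algebraically closed of characteristic `p`) is modular: there are a
level `N ≥ 1`, a weight `w`, a newform `f ∈ S_w(Γ₁(N))` and `ι : 𝓞_f →+* k` with
`charpoly ρ̄(Frob_q) = ι(X² − a_q(f) X + ε_f(q) q^{w−1})` for all primes `q ∤ N p`
(equivalently, `ρ̄` being irreducible, `ρ̄ ≅ ρ̄_{f,ι}`).  The instance hypotheses
`[Fact p.Prime] [CharP k p] [IsAlgClosed k]`, not consumed by the conclusion, are genuine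
hypotheses of the cited theorem and are kept in the signature on purpose.
[cite: KhareWintenberger2009, Thm. 1.2 and Thm. 9.1 (with Serre, Duke Math. J. 54 (1987) (3.2.3))]
[cite: Kisin2009TwoAdic, Thm. 0.1, Cor. 0.2] -/
def exists_newform_of_odd_irreducible : Prop :=
  ∀ [CharP k p] [IsAlgClosed k] (ρ : Literature.NumberTheory.GaloisRepresentations.ModPGaloisRep ℚ k 2) (hirr : ρ.toGaloisRep.IsIrreducible) (hodd : GaloisRepresentations.FramedGaloisRep.IsOdd ρ),
    ∃ (N : ℕ) (_ : NeZero N) (w : ℕ) (f : CuspForm (Gamma1 N) (w : ℤ))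
      (ι : coeffCharIntegers f →+* k),
      IsNewform1 f ∧ IsGaloisRepOfNewform1Int f ι {q | q ∣ N * p} ρ

end Literature.NumberTheory.Automorphic
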